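/-
Copyright (c) 2026 the pub-hodgecm-mathlib formalisation cell (harness21).  Prover seat hodgecm-mathlib-K2E3-p20 (g3), Track B «K2-LIT» ∕ h413 =
`stmt-HodgeConjecture-24833`, line `K2_E3_EllipticInputs`, unit U12 «Characters», socket #11 road (SC-an), END-GAME MAP v1 (K2 bus 2026-09-04T02:08:19Z)
brick [M1]: the FIELD-MODEL twin of ★ `K2E3SupercuspOrbitalSliceCuspidal` — on `U(σ, Φ₃)(K)`, `K` a non-archimedean local field, the orbital slice
`f_t(x) = θ(x t x⁻¹)` of a supercuspidal coefficient `θ` at a regular diagonal `t` is continuous, right-`T`-invariant, and cuspidal along `N` AND along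
`N̄ = w₀ N w₀⁻¹`, each for every Haar measure of the respective subgroup (the currency of ★ `K2E3CuspFormCancellationCore` ∕ `…U3Inputs`).
-/
import Summits.HodgeConjecture.HodgeConjecture.Theorems.K2E3UnipotentConjTwistBochner             -- ★ p856617 (this seat): Lemma 22 Bochner form, slice cuspidality (`N` and the `w`-twin), right-invariance
import Literature.NumberTheory.Automorphic.U3SupercuspFormUnipotentIntegral                    -- ★ `integral_dual_apply_unipotentU_eq_zero_of_isSupercuspidal`, `exists_compactOpen_subgroups_exhausting_unipotentU_three`
import Summits.HodgeConjecture.HodgeConjecture.Theorems.K2E1SupercuspidalCoefficientNCuspidal  -- ★ `integrable_∕continuous_sesqForm_apply_translate_restrict`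
import Summits.HodgeConjecture.HodgeConjecture.Theorems.F0P3cStCharTSWeylHypFibre             -- ★ `isUnit_sub_of_isRegularElt_glDiagonal`
import Literature.NumberTheory.Automorphic.RegularDiagonalCentralizer                         -- ★ `mem_torusU_iff_mem_centralizer_of_isUnit_sub`
import Literature.NumberTheory.Automorphic.UnitaryGroupRankOneIwahoriDatum                    -- ★ `coe_weylLongU_mul_mul_weylLongU_of_eq_glDiagonal`, `weylLongU_mul_weylLongU`
import Literature.NumberTheory.Automorphic.SmoothRepresentationLocallyConstant                 -- ★ `Representation.IsSmooth.isLocallyConstant_apply`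
import Literature.MeasureTheory.Group.HaarUnionCompactSubgroups                               -- ★ `isMulRightInvariant_of_iUnion_isCompact_subgroup`
import HarnessLib

/-!
# K2_E3 road (h413), socket #11 (SC-an), [M1]: THE ORBITAL SLICE OF A SUPERCUSPIDAL COEFFICIENT OF `U(σ, Φ₃)(K)` IS A HARISH-CHANDRA CUSP FORM —
# field-model twin of ★ `K2E3SupercuspOrbitalSliceCuspidal` (cuspidality along `N` and along `N̄ = w₀Nw₀⁻¹`, each for EVERY Haar measure)

Cell `pub/hodgecm-mathlib`, Track B «K2-LIT», crux H413 = `stmt-HodgeConjecture-24833` (`--supports … --as helper`, count-neutral).  The Theorem-20 machinery of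
the (SC-an) line (★ `K2E3IwahoriFactorisedLevelU3`, ★ `K2E3CuspFormCancellationCore` ∕ `Heights` ∕ `LevelOne` ∕ `U3Torus` ∕ `U3Inputs`) lives on the one-place
FIELD model `U(σ, Φ₃)(K)`; its cusp form `f` enters through `hcusp : ∀ x, ∫ n : ↥N, f (x * ↑n) ∂ν = 0` (Haar `ν` on `↥N`) and the same along `N̄` with its own Haar
`ν̄`.  This file supplies both for `f = f_t`, `t = diag d` REGULAR, `θ = B u' (ρ(·) u)` a coefficient of a smooth SUPERCUSPIDAL `ρ` (hypotheses: `σ` a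
continuous involution, `2 ≠ 0`, scalar and compact centre, a `σ`-fixed `ϖ` with `0 < |ϖ| < 1` — all ★ at `K = L_w`, see ★ `u3_isSupercuspidal_iff_jacquet_eq_zero_mp`):

* §1 `exists_isHaarMeasure_integral_map_conj_eq` (abstract `G`): a Haar measure `ν̄` of `↥(N.map (conj w))` is the push-forward of a Haar measure `ν` of `↥N`:
  `∫ m, F ↑m ∂ν̄ = ∫ n, F (w ↑n w⁻¹) ∂ν`.
* §2 `integral_coeff_translate_unipotentU_eq_zero_of_isSupercuspidal` — two-sided `N`-cuspidality `∫_N B u' (ρ(a n b) u) dν = 0` for EVERY Haar `ν` (★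
  `integral_dual_apply_unipotentU_eq_zero_of_isSupercuspidal` with right-invariance ★ `isMulRightInvariant_of_iUnion_isCompact_subgroup` ∘ ★ exhaustion and
  integrability ★ `integrable_sesqForm_apply_translate_restrict`); **`integral_coeff_conj_unipotentU_eq_zero_of_isSupercuspidal`** (`∫_N θ(a · n t n⁻¹ · b) dν = 0`);
  `integral_coeff_slice_unipotentU_eq_zero_of_isSupercuspidal` (`∫_N f_t(x n) dν = 0`); **`integral_coeff_slice_unipotentU_map_conj_weylLongU_eq_zero_of_isSupercuspidal`**
  (`∫_{N̄} f_t(x n̄) dν̄ = 0`, `t' = w₀ t w₀ = diag(d ∘ rev)` ★); `continuous_coeff_conj`, `coeff_conj_mul_eq_of_mem_torusU`.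

HONEST LABEL: HC_CM is proved only modulo the 7 printed citations (2 remaining named inputs: hLiu418 = stmt-HodgeConjecture-24832, h413 =
stmt-HodgeConjecture-24833) until rung 0 closes; this file is a count-neutral helper.

## References
* [HarishChandra1970] Harish-Chandra (notes by G. van Dijk), *Harmonic Analysis on Reductive p-adic Groups*, LNM 162 (1970), Part I §3 p. 9; Part V §6
  Lemma 22 p. 42; Part VII §2 Theorem 20 p. 70 (i)(ii).
* [Rogawski1990] J. D. Rogawski, *Automorphic Representations of Unitary Groups in Three Variables*, Ann. of Math. Stud. 123 (1990), §1.10 p. 9, §3.1 p. 19,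
  §4.9 p. 54, §12.2 p. 173.
* [Casselman1995] W. Casselman, *Introduction to the theory of admissible representations of p-adic reductive groups* (1995), Prop. 1.4.4, Thm. 5.3.1.
* [Folland1995] G. B. Folland, *A Course in Abstract Harmonic Analysis* (1995), §2.4 (Haar measure under topological isomorphisms).
-/

set_option autoImplicit false
-- the mandated namespace repeats the single-problem summit's segment (`HodgeConjecture.HodgeConjecture`)
set_option linter.dupNamespace false

noncomputable section

open MeasureTheory Measure Set Filter Topology
open scoped NNReal ENNReal Pointwise Matrix MatrixGroups

namespace Summit.HodgeConjecture.HodgeConjecture.Cruxes.H413.K2E3SupercuspOrbitalSliceCuspidalModel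

open K2E3UnipotentConjTwistBochner

/-! ## §1 Abstract group: a Haar measure of `wNw⁻¹` is the push-forward of a Haar measure of `N` -/

/-- **`∫_{wNw⁻¹} F dν̄ = ∫_N F(w n w⁻¹) dν` for some Haar `ν` on `N`**: conjugation by `w` is a topological isomorphism `N ≃ₜ* N.map (conj w)`, so the
pull-back of the Haar measure `ν̄` is a Haar measure `ν` of `N` (Mathlib `ContinuousMulEquiv.isHaarMeasure_map`) and integrals correspond (Mathlib
`integral_map_equiv`). [cite: Folland1995, §2.4] [cite: Rogawski1990, §1.10 p. 9] -/
theorem exists_isHaarMeasure_integral_map_conj_eq {G : Type*} [Group G] [TopologicalSpace G] [IsTopologicalGroup G] (N : Subgroup G) (w : G)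
    [MeasurableSpace ↥N] [BorelSpace ↥N]
    [MeasurableSpace ↥(N.map (MulAut.conj w).toMonoidHom)] [BorelSpace ↥(N.map (MulAut.conj w).toMonoidHom)]
    (ν' : Measure ↥(N.map (MulAut.conj w).toMonoidHom)) [IsHaarMeasure ν'] {E : Type*} [NormedAddCommGroup E] [NormedSpace ℝ E] :
    ∃ ν : Measure ↥N, IsHaarMeasure ν ∧ ∀ F : G → E, ∫ m, F (m : G) ∂ν' = ∫ n, F (w * (n : G) * w⁻¹) ∂ν := by
  have hmem : ∀ n : ↥N, w * (n : G) * w⁻¹ ∈ N.map (MulAut.conj w).toMonoidHom := fun n =>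
    Subgroup.mem_map.2 ⟨n, n.2, rfl⟩
  have hmem' : ∀ m : ↥(N.map (MulAut.conj w).toMonoidHom), w⁻¹ * (m : G) * w ∈ N := fun m => by
    obtain ⟨n, hn, hnm⟩ := Subgroup.mem_map.1 m.2
    rw [← hnm, MulEquiv.coe_toMonoidHom, MulAut.conj_apply, show w⁻¹ * (w * n * w⁻¹) * w = n by group]
    exact hn
  let e : ↥N ≃ₜ* ↥(N.map (MulAut.conj w).toMonoidHom) :=
    { toFun := fun n => ⟨w * (n : G) * w⁻¹, hmem n⟩
      invFun := fun m => ⟨w⁻¹ * (m : G) * w, hmem' m⟩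
      left_inv := fun n => Subtype.ext (by group)
      right_inv := fun m => Subtype.ext (by group)
      map_mul' := fun a b => Subtype.ext (by simp only [Subgroup.coe_mul]; group)
      continuous_toFun := Continuous.subtype_mk ((continuous_const.mul continuous_subtype_val).mul continuous_const) _
      continuous_invFun := Continuous.subtype_mk ((continuous_const.mul continuous_subtype_val).mul continuous_const) _ }
  let em : ↥N ≃ᵐ ↥(N.map (MulAut.conj w).toMonoidHom) := e.toHomeomorph.toMeasurableEquiv
  have hem : ∀ n : ↥N, ((em n : ↥(N.map (MulAut.conj w).toMonoidHom)) : G) = w * (n : G) * w⁻¹ := fun n => rfl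
  have hν : IsHaarMeasure (ν'.map em.symm) := e.symm.isHaarMeasure_map ν'
  refine ⟨ν'.map em.symm, hν, fun F => ?_⟩
  conv_lhs => rw [← MeasurableEquiv.map_map_symm em (ν := ν')]
  rw [integral_map_equiv em]
  exact integral_congr_ae (Eventually.of_forall fun n => by simp only [hem])

/-! ## §2 The field model `U(σ, Φ₃)(K)` over a non-archimedean local field -/

section Model

open ValuativeRel
open Literature.NumberTheory.Automorphic Literature.NumberTheory.Automorphic.UnitaryGroup
  Literature.NumberTheory.Automorphic.UnitaryGroup.HeisRing Literature.NumberTheory.Rogawski1990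

variable {K : Type*} [Field K] [ValuativeRel K] [TopologicalSpace K] [IsNonarchimedeanLocalField K]

set_option synthInstance.maxHeartbeats 400000 in
set_option maxHeartbeats 1600000 in
-- instance-term unification on the model carriers
/-- **SUPERCUSPIDAL COEFFICIENTS OF `U(σ, Φ₃)(K)` ARE TWO-SIDEDLY `N`-CUSPIDAL FOR EVERY HAAR MEASURE OF `N(K)`.**  `σ` continuous, `J = Φ₃`, centre SCALAR
(`hZs`) and COMPACT (`hZc`), `ϖ ≠ 0` `σ`-fixed with `|ϖ| < 1`; `ρ` smooth supercuspidal with a `U`-invariant sesquilinear form `B`; `ν` ANY Haar measure on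
`↥(unipotentU σ J)`.  Then `∫_N B u' (ρ(a n b) u) dν(n) = 0` (★ `integral_dual_apply_unipotentU_eq_zero_of_isSupercuspidal`; right-invariance of `ν` by ★
`isMulRightInvariant_of_iUnion_isCompact_subgroup` ∘ ★ `exists_compactOpen_subgroups_exhausting_unipotentU_three`; integrability ★
`integrable_sesqForm_apply_translate_restrict`). [cite: HarishChandra1970, Part I §3 p. 9] [cite: Casselman1995, Thm. 5.3.1] [cite: Rogawski1990, §12.2 p. 173] -/
theorem integral_coeff_translate_unipotentU_eq_zero_of_isSupercuspidal [SecondCountableTopology (GL (Fin 3) K)]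
    (σ : K →+* K) (hσc : Continuous σ) {J : Matrix (Fin 3) (Fin 3) K} (hJ : J = (StdForm.antidiagonal 3).over K)
    (hZs : ∀ z ∈ Subgroup.center ↥(unitaryGroupOfForm σ J), ∃ u : Kˣ,
      ((z : ↥(unitaryGroupOfForm σ J)) : GL (Fin 3) K) = Matrix.GeneralLinearGroup.scalar (Fin 3) u)
    (hZc : IsCompact ((Subgroup.center ↥(unitaryGroupOfForm σ J) : Subgroup ↥(unitaryGroupOfForm σ J)) : Set ↥(unitaryGroupOfForm σ J)))
    {ϖ : K} (hϖ0 : ϖ ≠ 0) (hϖ1 : valuation K ϖ < 1) (hσϖ : σ ϖ = ϖ)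
    {V : Type*} [AddCommGroup V] [Module ℂ V] (ρ : Representation ℂ ↥(unitaryGroupOfForm σ J) V) (hsm : ρ.IsSmooth) (hsc : ρ.IsSupercuspidal)
    (B : V →ₗ⋆[ℂ] V →ₗ[ℂ] ℂ) (hBinv : ∀ (g : ↥(unitaryGroupOfForm σ J)) (x y : V), B (ρ g x) (ρ g y) = B x y)
    [MeasurableSpace ↥(unipotentU σ J)] [BorelSpace ↥(unipotentU σ J)] (ν : Measure ↥(unipotentU σ J)) [IsHaarMeasure ν]
    (a b : ↥(unitaryGroupOfForm σ J)) (u u' : V) :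
    ∫ n, B u' (ρ (a * (n : ↥(unitaryGroupOfForm σ J)) * b) u) ∂ν = 0 := by
  haveI : T2Space K := (Literature.NumberTheory.GaloisRepresentations.IsNonarchimedeanLocalField.isLocalField K).toT2Space
  haveI : SecondCountableTopology ↥(unitaryGroupOfForm σ J) := TopologicalSpace.Subtype.secondCountableTopology _
  haveI : SecondCountableTopology ↥(unipotentU σ J) := TopologicalSpace.Subtype.secondCountableTopology _
  obtain ⟨Nj, -, hc, ho, hex⟩ := exists_compactOpen_subgroups_exhausting_unipotentU_three σ hJ hσc hϖ0 hϖ1 hσϖ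
  haveI : WeaklyLocallyCompactSpace ↥(unipotentU σ J) :=
    ⟨fun n => by obtain ⟨j, hj⟩ := hex n; exact ⟨_, hc j, (ho j).mem_nhds hj⟩⟩
  haveI : ν.IsMulRightInvariant := Literature.MeasureTheory.Group.isMulRightInvariant_of_iUnion_isCompact_subgroup ν Nj hc hex
  have hN : IsClosed ((unipotentU σ J : Subgroup ↥(unitaryGroupOfForm σ J)) : Set ↥(unitaryGroupOfForm σ J)) :=
    (isClosed_upperUnitriangular (n := 3) (R := K)).preimage continuous_subtype_val
  exact integral_dual_apply_unipotentU_eq_zero_of_isSupercuspidal σ hJ hσc hZs hϖ0 hϖ1 hσϖ ρ hsm hsc ν (B u') u a b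
    (K2E1SupercuspidalCoefficientNCuspidal.integrable_sesqForm_apply_translate_restrict ρ (unipotentU σ J) ν hsc hZc hsm hBinv hN a b u u')

set_option synthInstance.maxHeartbeats 400000 in
set_option maxHeartbeats 1600000 in
-- instance-term unification on the model carriers
/-- **THE HEAD AT THE MODEL — `∫_N θ(a · n t n⁻¹ · b) dν = 0`** for `θ = B u' (ρ(·) u)` a supercuspidal coefficient of `U(σ, Φ₃)(K)` (`σ` a continuous involution,
`2 ≠ 0`, `K` second countable) and `t = diag d` REGULAR (★ `isUnit_sub_of_isRegularElt_glDiagonal`): Lemma 22 (★ p856617 §2) ∘ the cusp condition (§2).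
[cite: HarishChandra1970, Part V §6 Lemma 22 p. 42; Part VII §2 p. 70 (ii)] [cite: Rogawski1990, §4.9 p. 54] -/
theorem integral_coeff_conj_unipotentU_eq_zero_of_isSupercuspidal [SecondCountableTopology K] [SecondCountableTopology (GL (Fin 3) K)]
    [MeasurableSpace K] [BorelSpace K]
    (σ : K →+* K) (hσ : ∀ x, σ (σ x) = x) (hσc : Continuous σ) (h2 : (2 : K) ≠ 0)
    {J : Matrix (Fin 3) (Fin 3) K} (hJ : J = (StdForm.antidiagonal 3).over K)
    (hZs : ∀ z ∈ Subgroup.center ↥(unitaryGroupOfForm σ J), ∃ u : Kˣ,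
      ((z : ↥(unitaryGroupOfForm σ J)) : GL (Fin 3) K) = Matrix.GeneralLinearGroup.scalar (Fin 3) u)
    (hZc : IsCompact ((Subgroup.center ↥(unitaryGroupOfForm σ J) : Subgroup ↥(unitaryGroupOfForm σ J)) : Set ↥(unitaryGroupOfForm σ J)))
    {ϖ : K} (hϖ0 : ϖ ≠ 0) (hϖ1 : valuation K ϖ < 1) (hσϖ : σ ϖ = ϖ)
    {V : Type*} [AddCommGroup V] [Module ℂ V] (ρ : Representation ℂ ↥(unitaryGroupOfForm σ J) V) (hsm : ρ.IsSmooth) (hsc : ρ.IsSupercuspidal)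
    (B : V →ₗ⋆[ℂ] V →ₗ[ℂ] ℂ) (hBinv : ∀ (g : ↥(unitaryGroupOfForm σ J)) (x y : V), B (ρ g x) (ρ g y) = B x y)
    [MeasurableSpace ↥(unipotentU σ J)] [BorelSpace ↥(unipotentU σ J)] (ν : Measure ↥(unipotentU σ J)) [IsHaarMeasure ν]
    (t : ↥(unitaryGroupOfForm σ J)) {d : Fin 3 → Kˣ} (hd : glDiagonal 3 K d = (t : GL (Fin 3) K)) (hreg : IsRegularElt (t : GL (Fin 3) K))
    (a b : ↥(unitaryGroupOfForm σ J)) (u u' : V) :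
    ∫ n, B u' (ρ (a * ((n : ↥(unitaryGroupOfForm σ J)) * t * (n : ↥(unitaryGroupOfForm σ J))⁻¹) * b) u) ∂ν = 0 := by
  haveI : T2Space K := (Literature.NumberTheory.GaloisRepresentations.IsNonarchimedeanLocalField.isLocalField K).toT2Space
  letI : Invertible (2 : K) := invertibleOfNonzero h2
  have hreg' : IsRegularElt (glDiagonal 3 K d) := by rw [hd]; exact hreg
  have ha : IsUnit ((((d 0)⁻¹ * d 1 : Kˣ) : K) - 1) :=
    isUnit_coe_inv_mul_sub_one (F0P3cStCharTSWeylHypFibre.isUnit_sub_of_isRegularElt_glDiagonal hreg' (by decide))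
  have hb : IsUnit ((((d 0)⁻¹ * d 2 : Kˣ) : K) - 1) :=
    isUnit_coe_inv_mul_sub_one (F0P3cStCharTSWeylHypFibre.isUnit_sub_of_isRegularElt_glDiagonal hreg' (by decide))
  have ht : t ∈ torusU σ J := (mem_torusU_iff t).2 ⟨d, hd⟩
  exact integral_conj_unipotentU_eq_zero_of_forall_integral_eq_zero σ hσ hσc hJ ν ⟨t, ht⟩ hd ha hb (fun g => B u' (ρ g u))
    (fun a' b' => integral_coeff_translate_unipotentU_eq_zero_of_isSupercuspidal σ hσc hJ hZs hZc hϖ0 hϖ1 hσϖ ρ hsm hsc B hBinv ν a' b' u u')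
    (fun a' b' => (K2E1SupercuspidalCoefficientNCuspidal.continuous_sesqForm_apply_translate_restrict ρ (unipotentU σ J) (B := B) hsm a' b' u u').aestronglyMeasurable)
    a b

set_option synthInstance.maxHeartbeats 400000 in
set_option maxHeartbeats 1600000 in
-- instance-term unification on the model carriers
/-- **(Φ_C (ii) along `N`)** `∫_N f_t(x n) dν = 0` for every `x` and every Haar `ν` on `N(K)` (the head at `(x, x⁻¹)`) — the hypothesis `hcusp` of ★
`K2E3CuspFormCancellationCore` for `f = f_t`. [cite: HarishChandra1970, Part VII §2 p. 70 (ii)] -/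
theorem integral_coeff_slice_unipotentU_eq_zero_of_isSupercuspidal [SecondCountableTopology K] [SecondCountableTopology (GL (Fin 3) K)]
    [MeasurableSpace K] [BorelSpace K]
    (σ : K →+* K) (hσ : ∀ x, σ (σ x) = x) (hσc : Continuous σ) (h2 : (2 : K) ≠ 0)
    {J : Matrix (Fin 3) (Fin 3) K} (hJ : J = (StdForm.antidiagonal 3).over K)
    (hZs : ∀ z ∈ Subgroup.center ↥(unitaryGroupOfForm σ J), ∃ u : Kˣ,
      ((z : ↥(unitaryGroupOfForm σ J)) : GL (Fin 3) K) = Matrix.GeneralLinearGroup.scalar (Fin 3) u)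
    (hZc : IsCompact ((Subgroup.center ↥(unitaryGroupOfForm σ J) : Subgroup ↥(unitaryGroupOfForm σ J)) : Set ↥(unitaryGroupOfForm σ J)))
    {ϖ : K} (hϖ0 : ϖ ≠ 0) (hϖ1 : valuation K ϖ < 1) (hσϖ : σ ϖ = ϖ)
    {V : Type*} [AddCommGroup V] [Module ℂ V] (ρ : Representation ℂ ↥(unitaryGroupOfForm σ J) V) (hsm : ρ.IsSmooth) (hsc : ρ.IsSupercuspidal)
    (B : V →ₗ⋆[ℂ] V →ₗ[ℂ] ℂ) (hBinv : ∀ (g : ↥(unitaryGroupOfForm σ J)) (x y : V), B (ρ g x) (ρ g y) = B x y)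
    [MeasurableSpace ↥(unipotentU σ J)] [BorelSpace ↥(unipotentU σ J)] (ν : Measure ↥(unipotentU σ J)) [IsHaarMeasure ν]
    (t : ↥(unitaryGroupOfForm σ J)) {d : Fin 3 → Kˣ} (hd : glDiagonal 3 K d = (t : GL (Fin 3) K)) (hreg : IsRegularElt (t : GL (Fin 3) K))
    (u u' : V) (x : ↥(unitaryGroupOfForm σ J)) :
    ∫ n, B u' (ρ (x * (n : ↥(unitaryGroupOfForm σ J)) * t * (x * (n : ↥(unitaryGroupOfForm σ J)))⁻¹) u) ∂ν = 0 := by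
  have h := integral_coeff_conj_unipotentU_eq_zero_of_isSupercuspidal σ hσ hσc h2 hJ hZs hZc hϖ0 hϖ1 hσϖ ρ hsm hsc B hBinv ν t hd hreg x x⁻¹ u u'
  have heq : (fun n : ↥(unipotentU σ J) => B u' (ρ (x * (n : ↥(unitaryGroupOfForm σ J)) * t * (x * (n : ↥(unitaryGroupOfForm σ J)))⁻¹) u)) =
      fun n : ↥(unipotentU σ J) => B u' (ρ (x * ((n : ↥(unitaryGroupOfForm σ J)) * t * (n : ↥(unitaryGroupOfForm σ J))⁻¹) * x⁻¹) u) := by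
    funext n; congr 2; group
  rw [heq]; exact h

set_option synthInstance.maxHeartbeats 400000 in
set_option maxHeartbeats 1600000 in
-- instance-term unification on the model carriers
/-- **(Φ_C (ii) along `N̄ = w₀Nw₀⁻¹`)** `∫_{N̄} f_t(x n̄) dν̄ = 0` for every `x` and every Haar `ν̄` on `↥(N.map (conj w₀))` (§1 + the `w`-twin ★ p856617 §2 at
`t' = w₀ t w₀ = diag(d ∘ rev)`, ★ `coe_weylLongU_mul_mul_weylLongU_of_eq_glDiagonal`, `w₀² = 1`) — the second `hcusp` of ★ `K2E3CuspFormCancellationCore` for `f = f_t`.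
[cite: HarishChandra1970, Part VII §2 p. 70 (ii)] [cite: Rogawski1990, §1.10 p. 9] -/
theorem integral_coeff_slice_unipotentU_map_conj_weylLongU_eq_zero_of_isSupercuspidal [SecondCountableTopology K]
    [SecondCountableTopology (GL (Fin 3) K)] [MeasurableSpace K] [BorelSpace K]
    (σ : K →+* K) (hσ : ∀ x, σ (σ x) = x) (hσc : Continuous σ) (h2 : (2 : K) ≠ 0)
    {J : Matrix (Fin 3) (Fin 3) K} (hJ : J = (StdForm.antidiagonal 3).over K)
    (hZs : ∀ z ∈ Subgroup.center ↥(unitaryGroupOfForm σ J), ∃ u : Kˣ,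
      ((z : ↥(unitaryGroupOfForm σ J)) : GL (Fin 3) K) = Matrix.GeneralLinearGroup.scalar (Fin 3) u)
    (hZc : IsCompact ((Subgroup.center ↥(unitaryGroupOfForm σ J) : Subgroup ↥(unitaryGroupOfForm σ J)) : Set ↥(unitaryGroupOfForm σ J)))
    {ϖ : K} (hϖ0 : ϖ ≠ 0) (hϖ1 : valuation K ϖ < 1) (hσϖ : σ ϖ = ϖ)
    {V : Type*} [AddCommGroup V] [Module ℂ V] (ρ : Representation ℂ ↥(unitaryGroupOfForm σ J) V) (hsm : ρ.IsSmooth) (hsc : ρ.IsSupercuspidal)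
    (B : V →ₗ⋆[ℂ] V →ₗ[ℂ] ℂ) (hBinv : ∀ (g : ↥(unitaryGroupOfForm σ J)) (x y : V), B (ρ g x) (ρ g y) = B x y)
    [MeasurableSpace ↥(unipotentU σ J)] [BorelSpace ↥(unipotentU σ J)]
    [MeasurableSpace ↥((unipotentU σ J).map (MulAut.conj (weylLongU σ hJ)).toMonoidHom)]
    [BorelSpace ↥((unipotentU σ J).map (MulAut.conj (weylLongU σ hJ)).toMonoidHom)]
    (ν' : Measure ↥((unipotentU σ J).map (MulAut.conj (weylLongU σ hJ)).toMonoidHom)) [IsHaarMeasure ν']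
    (t : ↥(unitaryGroupOfForm σ J)) {d : Fin 3 → Kˣ} (hd : glDiagonal 3 K d = (t : GL (Fin 3) K)) (hreg : IsRegularElt (t : GL (Fin 3) K))
    (u u' : V) (x : ↥(unitaryGroupOfForm σ J)) :
    ∫ m, B u' (ρ (x * (m : ↥(unitaryGroupOfForm σ J)) * t * (x * (m : ↥(unitaryGroupOfForm σ J)))⁻¹) u) ∂ν' = 0 := by
  haveI : T2Space K := (Literature.NumberTheory.GaloisRepresentations.IsNonarchimedeanLocalField.isLocalField K).toT2Space
  letI : Invertible (2 : K) := invertibleOfNonzero h2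
  obtain ⟨ν, hν, hF⟩ := exists_isHaarMeasure_integral_map_conj_eq (unipotentU σ J) (weylLongU σ hJ) ν' (E := ℂ)
  haveI : IsHaarMeasure ν := hν
  rw [hF (fun g => B u' (ρ (x * g * t * (x * g)⁻¹) u))]
  -- `t' = w₀ t w₀ = diag (d ∘ rev)` is regular diagonal, and `w₀⁻¹ t w₀ = t'`
  have hreg' : IsRegularElt (glDiagonal 3 K d) := by rw [hd]; exact hreg
  have hw0 : (weylLongU σ hJ)⁻¹ = weylLongU σ hJ := inv_eq_of_mul_eq_one_right (weylLongU_mul_weylLongU σ hJ)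
  have hd' : glDiagonal 3 K (d ∘ Fin.rev) = ((weylLongU σ hJ * t * weylLongU σ hJ : ↥(unitaryGroupOfForm σ J)) : GL (Fin 3) K) :=
    (coe_weylLongU_mul_mul_weylLongU_of_eq_glDiagonal σ hJ hd.symm).symm
  have ht' : weylLongU σ hJ * t * weylLongU σ hJ ∈ torusU σ J := (mem_torusU_iff _).2 ⟨d ∘ Fin.rev, hd'⟩
  have hw : (weylLongU σ hJ)⁻¹ * t * weylLongU σ hJ = ((⟨weylLongU σ hJ * t * weylLongU σ hJ, ht'⟩ : ↥(torusU σ J)) : ↥(unitaryGroupOfForm σ J)) := by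
    rw [hw0]
  have ha' : IsUnit (((((d ∘ Fin.rev) 0)⁻¹ * (d ∘ Fin.rev) 1 : Kˣ) : K) - 1) :=
    isUnit_coe_inv_mul_sub_one (F0P3cStCharTSWeylHypFibre.isUnit_sub_of_isRegularElt_glDiagonal hreg' (by decide))
  have hb' : IsUnit (((((d ∘ Fin.rev) 0)⁻¹ * (d ∘ Fin.rev) 2 : Kˣ) : K) - 1) :=
    isUnit_coe_inv_mul_sub_one (F0P3cStCharTSWeylHypFibre.isUnit_sub_of_isRegularElt_glDiagonal hreg' (by decide))
  have h := integral_conj_conj_unipotentU_eq_zero_of_forall_integral_eq_zero σ hσ hσc hJ ν t (weylLongU σ hJ)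
    ⟨weylLongU σ hJ * t * weylLongU σ hJ, ht'⟩ hw hd' ha' hb' (fun g => B u' (ρ g u))
    (fun a' b' => integral_coeff_translate_unipotentU_eq_zero_of_isSupercuspidal σ hσc hJ hZs hZc hϖ0 hϖ1 hσϖ ρ hsm hsc B hBinv ν a' b' u u')
    (fun a' b' => (K2E1SupercuspidalCoefficientNCuspidal.continuous_sesqForm_apply_translate_restrict ρ (unipotentU σ J) (B := B) hsm a' b' u u').aestronglyMeasurable)
    x x⁻¹
  have heq : (fun n : ↥(unipotentU σ J) => B u' (ρ (x * (weylLongU σ hJ * (n : ↥(unitaryGroupOfForm σ J)) * (weylLongU σ hJ)⁻¹) * t *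
      (x * (weylLongU σ hJ * (n : ↥(unitaryGroupOfForm σ J)) * (weylLongU σ hJ)⁻¹))⁻¹) u)) =
      fun n : ↥(unipotentU σ J) => B u' (ρ (x * (weylLongU σ hJ * (n : ↥(unitaryGroupOfForm σ J)) * (weylLongU σ hJ)⁻¹) * t *
        (weylLongU σ hJ * (n : ↥(unitaryGroupOfForm σ J)) * (weylLongU σ hJ)⁻¹)⁻¹ * x⁻¹) u) := by
    funext n; congr 2; group
  rw [heq]; exact h

/-- **(Φ_C, continuity)** the slice `x ↦ B u' (ρ(x t x⁻¹) u)` is continuous for a smooth `ρ` (locally constant coefficient ★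
`Representation.IsSmooth.isLocallyConstant_apply`). [cite: Casselman1995, Prop. 1.4.4] -/
theorem continuous_coeff_conj (σ : K →+* K) {J : Matrix (Fin 3) (Fin 3) K}
    {V : Type*} [AddCommGroup V] [Module ℂ V] (ρ : Representation ℂ ↥(unitaryGroupOfForm σ J) V) (hsm : ρ.IsSmooth)
    (B : V →ₗ⋆[ℂ] V →ₗ[ℂ] ℂ) (t : ↥(unitaryGroupOfForm σ J)) (u u' : V) :
    Continuous fun x : ↥(unitaryGroupOfForm σ J) => B u' (ρ (x * t * x⁻¹) u) :=
  (((Representation.IsSmooth.isLocallyConstant_apply ρ hsm u).comp fun w : V => B u' w).continuous).comp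
    ((continuous_id.mul continuous_const).mul continuous_inv)

omit [ValuativeRel K] [TopologicalSpace K] [IsNonarchimedeanLocalField K] in
/-- **(Φ_C (i), right-`T`-invariance)** `f_t(x z) = f_t(x)` for `z ∈ T` and `t = diag d` REGULAR (`Z(t) = T`, ★ `mem_torusU_iff_mem_centralizer_of_isUnit_sub`).
[cite: HarishChandra1970, Part VII §2 p. 70 (i)] [cite: Rogawski1990, §3.6 p. 31] -/
theorem coeff_conj_mul_eq_of_mem_torusU (σ : K →+* K) {J : Matrix (Fin 3) (Fin 3) K}
    {V : Type*} [AddCommGroup V] [Module ℂ V] (ρ : Representation ℂ ↥(unitaryGroupOfForm σ J) V)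
    (B : V →ₗ⋆[ℂ] V →ₗ[ℂ] ℂ) (t : ↥(unitaryGroupOfForm σ J)) {d : Fin 3 → Kˣ} (hd : glDiagonal 3 K d = (t : GL (Fin 3) K))
    (hreg : IsRegularElt (t : GL (Fin 3) K)) (u u' : V) (x : ↥(unitaryGroupOfForm σ J)) {z : ↥(unitaryGroupOfForm σ J)} (hz : z ∈ torusU σ J) :
    B u' (ρ (x * z * t * (x * z)⁻¹) u) = B u' (ρ (x * t * x⁻¹) u) := by
  have hreg' : IsRegularElt (glDiagonal 3 K d) := by rw [hd]; exact hreg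
  have hzc : z ∈ Subgroup.centralizer ({t} : Set ↥(unitaryGroupOfForm σ J)) :=
    (mem_torusU_iff_mem_centralizer_of_isUnit_sub hd
      (fun i j hij => F0P3cStCharTSWeylHypFibre.isUnit_sub_of_isRegularElt_glDiagonal hreg' hij) z).1 hz
  exact apply_mul_conj_eq_of_commute (fun g => B u' (ρ g u)) t x z (Subgroup.mem_centralizer_singleton_iff.1 hzc)

end Model

end Summit.HodgeConjecture.HodgeConjecture.Cruxes.H413.K2E3SupercuspOrbitalSliceCuspidalModel

end
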